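import Summits.BirchSwinnertonDyer.BirchSwinnertonDyer.Theorems.ManinLocalTwoThreeShimuraClasses
import Summits.BirchSwinnertonDyer.Rank1Residual.ManinAdditive.ShimuraIndexFrickeLaw
import HarnessLib

/-!
# C2 `ManinOddAtFour` ∩ C3 `ManinPrimeToThreeAtNine` helper (es g45, T-es-105) — THE SHIMURA QUOTIENT IS TRIVIAL AT THE
# DOUBLY-ADDITIVE GENUS-ONE LEVEL `36`: `Λ(f) = Λ₁(f)` and `ShimuraIndexPrimeTo p f` for EVERY `f ∈ S₂(Γ₀(36))` and every `p`, FACT-FREE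

HONEST FRAMING. Printed mathematics (Ling–Oesterlé 1991, Thm. 1: the Shimura subgroup `Σ(36) = ker(J₀(36) → J₁(36))` is
trivial; Stevens 1989 §2: the `X₀(36)`- and `X₁(36)`-optimal curves coincide, `36a1`), new formal proof. Beyond-print theorem: NO.
Nothing about the Manin constant of any curve is asserted; C2, C3, Manin's conjecture and BSD stay OPEN. No `sorry`, no new axiom,
no instance/notation.

WHAT. `36 = 4·9` is the unique genus-one level lying in BOTH crux domains (`4 ∣ N` for C2, `9 ∣ N` for C3). For every `γ ∈ Γ₀(36)`
the class of `{∞, γ∞}_f` modulo `Λ₁(f)` depends only on `±d_γ mod 36` (landed `cuspSymbol_sub_mem_periodLatticeGamma1_of_apply_eq(_neg)`),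
`d_γ` runs over the `12` units of `ℤ/36` (`units_thirtySix`, `decide`), and the FIVE PARABOLIC elements
`P_w = (1 − 6w, w; −36w, 1 + 6w) = k (1 w; 0 1) k⁻¹`, `k = (1 0; 6 1)` (all fixing the cusp `1/6`), `w = 1, …, 5`, have period `0`
(landed `periodFunctional_eq_zero_of_conj_upper`) and lower-right entries `7, 13, 19, 25, 31` — together with `±1` these exhaust
`(ℤ/36)ˣ`. Hence **`cuspSymbol_mem_periodLatticeGamma1_thirtySix : {∞, γ∞}_f ∈ Λ₁(f)` for all `γ ∈ Γ₀(36)`**,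
**`periodLattice_eq_periodLatticeGamma1_thirtySix : Λ(f) = Λ₁(f)`** and **`shimuraIndexPrimeTo_thirtySix (p) (f) : ShimuraIndexPrimeTo p f`**
for EVERY `f` (no `f ≠ 0`, no dimension count, no Hecke input). There are no elliptic points to account for (`4 ∣ 36`, `9 ∣ 36`).
C2/C3 READING (positive datum, fact-free): at `N = 36` the route's Shimura hypotheses `ShimuraIndexPrimeTo 2 D.f`, `ShimuraIndexPrimeTo 3 D.f`
hold for every modular parametrisation datum (`shimuraIndexPrimeTo_of_data_thirtySix`), in contrast with the neighbouring additive
genus-one levels `20, 24, 32` (index exactly `2`, T-es-102/104) and `27` (index divisible by `3`, T-es-103); E15-LATTICE-INDEX-v1 row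
`36a1`: index `1` ✓ (now a theorem on all of `S₂(Γ₀(36))`).

§3 (DIMENSION-FREE DESCENT, fact-free interface for levels of genus `> 1`): the landed descent
`ShimuraClass.zsmul_cuspSymbol_not_mem_of_hom` needs `S₂(Γ₀(N)) = ℂ·f`; **`zsmul_cuspSymbol_not_mem_of_hom_of_ker`** replaces
that by the KERNEL CONDITION «`φ` vanishes on `K_f = {x ∈ H₁(X₀(N), ℤ) : x(f) = 0}`»: then `n·v(γ) ≠ 0 ⇒ n·{∞, γ∞}_f ∉ Λ₁(f)`.
So a newform `f` SEES a covering class `φ` as soon as `φ(K_f) = 0` — the entry point for Hecke (mod-`2` Eisenstein) separation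
of `f` from the old part at `N = 40, 48, 52, 64, 80, …` (E15: index `2`), where no dimension count is available.

References: [LingOesterle1991] Thm. 1; [Stevens1989] §2; [Manin1972] §1.5–1.7; [Mazur1977] §II.11.
-/

set_option autoImplicit false

noncomputable section

-- justification: the `Summit.BirchSwinnertonDyer.BirchSwinnertonDyer.…` path repeats a component (route-file convention)
set_option linter.dupNamespace false

open scoped Classical MatrixGroups

open CongruenceSubgroup Matrix.SpecialLinearGroup ModularGroup
open Literature.NumberTheory.EllipticCurves.ModularForms
open Summit.BirchSwinnertonDyer.BirchSwinnertonDyer.Theorems.ThetaLayerLambdaCongruenceAtTwo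
open Summit.BirchSwinnertonDyer.BirchSwinnertonDyer.Theorems.ManinLocalTwoThree.ShimuraClass
open Summit.BirchSwinnertonDyer.Rank1Residual.ManinAdditive.KatoCurve (ShimuraIndexPrimeTo)

namespace Summit.BirchSwinnertonDyer.BirchSwinnertonDyer.Theorems.ManinLocalTwoThree.ShimuraThirtySix

/-! ## §1. The parabolic elements at the cusp `1/6` -/

/-- `P_w = (1 − 6w, w; −36w, 1 + 6w) ∈ Γ₀(36)`: the stabiliser of the cusp `1/6` (`= k (1 w; 0 1) k⁻¹`, `k = (1 0; 6 1)`). [folklore] -/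
def parabolicSixth (w : ℤ) : Gamma0 36 :=
  ⟨⟨!![1 - 6 * w, w; -(36 * w), 1 + 6 * w], by rw [Matrix.det_fin_two_of]; ring⟩, by
    rw [Gamma0_mem]
    show (((-(36 * w) : ℤ) : ZMod 36)) = 0
    rw [Int.cast_neg, Int.cast_mul, show ((36 : ℤ) : ZMod 36) = 0 from by decide, zero_mul, neg_zero]⟩

/-- `k = (1 0; 6 1)`. [folklore] -/
def kSixth : SL(2, ℤ) := ⟨!![1, 0; 6, 1], by rw [Matrix.det_fin_two_of]; norm_num⟩

/-- `k⁻¹ = (1 0; −6 1)`. [folklore] -/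
def kSixthInv : SL(2, ℤ) := ⟨!![1, 0; -6, 1], by rw [Matrix.det_fin_two_of]; norm_num⟩

/-- `k · k⁻¹ = 1`. [folklore] -/
theorem kSixth_mul_inv : kSixth * kSixthInv = 1 := by
  apply Subtype.ext
  rw [Matrix.SpecialLinearGroup.coe_mul, Matrix.SpecialLinearGroup.coe_one]
  ext i j
  fin_cases i <;> fin_cases j <;> rfl

/-- **`{∞, P_w∞} = 0`** in `S₂(Γ₀(36))^∨` for every `w` (`k⁻¹ P_w k = (1 w; 0 1)` is upper triangular).
[cite: Manin1972, §1.5] -/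
theorem periodFunctional_parabolicSixth (w : ℤ) : periodFunctional 36 (parabolicSixth w) = 0 := by
  refine periodFunctional_eq_zero_of_conj_upper (parabolicSixth w) kSixth ?_
  rw [inv_eq_of_mul_eq_one_right kSixth_mul_inv]
  have a10 : kSixthInv 1 0 = -6 := rfl
  have a11 : kSixthInv 1 1 = 1 := rfl
  have k00 : kSixth 0 0 = 1 := rfl
  have k10 : kSixth 1 0 = 6 := rfl
  have p00 : ((parabolicSixth w : Gamma0 36) : SL(2, ℤ)) 0 0 = 1 - 6 * w := rfl
  have p01 : ((parabolicSixth w : Gamma0 36) : SL(2, ℤ)) 0 1 = w := rfl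
  have p10 : ((parabolicSixth w : Gamma0 36) : SL(2, ℤ)) 1 0 = -(36 * w) := rfl
  have p11 : ((parabolicSixth w : Gamma0 36) : SL(2, ℤ)) 1 1 = 1 + 6 * w := rfl
  simp only [Matrix.SpecialLinearGroup.coe_mul, Matrix.mul_apply, Fin.sum_univ_two, a10, a11, k00, k10, p00, p01, p10, p11]
  ring

/-- The twelve units of `ℤ/36`: `±1, ±7, ±13, ±19, ±25, ±31`. [folklore] -/
theorem units_thirtySix : ∀ a d : ZMod 36, a * d = 1 →
    d = 1 ∨ d = -1 ∨ d = 7 ∨ d = -7 ∨ d = 13 ∨ d = -13 ∨ d = 19 ∨ d = -19 ∨ d = 25 ∨ d = -25 ∨ d = 31 ∨ d = -31 := by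
  decide

/-! ## §2. `Λ(f) = Λ₁(f)` on `S₂(Γ₀(36))` -/

/-- **Every `Γ₀(36)`-period is a `Γ₁(36)`-period**: `{∞, γ∞}_f ∈ Λ₁(f)` for all `γ ∈ Γ₀(36)` and all `f ∈ S₂(Γ₀(36))`.
[cite: LingOesterle1991, Thm. 1] -/
theorem cuspSymbol_mem_periodLatticeGamma1_thirtySix (f : CuspForm (Gamma0 36) 2) (γ : Gamma0 36) :
    cuspSymbol f γ ∈ periodLatticeGamma1 f := by
  have hc : ((((γ : SL(2, ℤ)) 1 0 : ℤ) : ZMod 36)) = 0 := by exact_mod_cast Gamma0_mem.mp γ.2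
  have had : ((((γ : SL(2, ℤ)) 0 0 : ℤ) : ZMod 36)) * ((((γ : SL(2, ℤ)) 1 1 : ℤ) : ZMod 36)) = 1 := by
    have := congrArg (Int.cast : ℤ → ZMod 36) (sl_det (γ : SL(2, ℤ)))
    push_cast at this
    rw [hc, mul_zero, sub_zero] at this
    exact this
  have hP : ∀ w : ℤ, cuspSymbol f (parabolicSixth w) = 0 := fun w ↦ by
    rw [← periodFunctional_apply, periodFunctional_parabolicSixth, LinearMap.zero_apply]
  have h11 : ∀ w : ℤ, ((((parabolicSixth w : Gamma0 36) : SL(2, ℤ)) 1 1 : ℤ)) = 1 + 6 * w := fun w ↦ rfl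
  have key_pos : ∀ w : ℤ, ((((γ : SL(2, ℤ)) 1 1 : ℤ) : ZMod 36)) = ((1 + 6 * w : ℤ) : ZMod 36) →
      cuspSymbol f γ ∈ periodLatticeGamma1 f := fun w hw ↦ by
    have := cuspSymbol_sub_mem_periodLatticeGamma1_of_apply_eq f (parabolicSixth w) γ (by rw [h11, hw])
    rwa [hP, sub_zero] at this
  have key_neg : ∀ w : ℤ, ((((γ : SL(2, ℤ)) 1 1 : ℤ) : ZMod 36)) = -((1 + 6 * w : ℤ) : ZMod 36) →
      cuspSymbol f γ ∈ periodLatticeGamma1 f := fun w hw ↦ by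
    have := cuspSymbol_sub_mem_periodLatticeGamma1_of_apply_eq_neg f (parabolicSixth w) γ (by rw [h11, hw])
    rwa [hP, sub_zero] at this
  rcases units_thirtySix _ _ had with h | h | h | h | h | h | h | h | h | h | h | h
  · exact cuspSymbol_mem_periodLatticeGamma1_of_apply_eq_one f γ h
  · exact cuspSymbol_mem_periodLatticeGamma1_of_apply_eq_neg_one f γ h
  · exact key_pos 1 (by rw [h]; decide)
  · exact key_neg 1 (by rw [h]; decide)
  · exact key_pos 2 (by rw [h]; decide)
  · exact key_neg 2 (by rw [h]; decide)
  · exact key_pos 3 (by rw [h]; decide)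
  · exact key_neg 3 (by rw [h]; decide)
  · exact key_pos 4 (by rw [h]; decide)
  · exact key_neg 4 (by rw [h]; decide)
  · exact key_pos 5 (by rw [h]; decide)
  · exact key_neg 5 (by rw [h]; decide)

/-- **THE SHIMURA QUOTIENT IS TRIVIAL AT LEVEL `36`: `Λ(f) = Λ₁(f)` for every `f ∈ S₂(Γ₀(36))`** (E15 row `36a1`: index `1`).
[cite: LingOesterle1991, Thm. 1] -/
theorem periodLattice_eq_periodLatticeGamma1_thirtySix (f : CuspForm (Gamma0 36) 2) :
    periodLattice f = periodLatticeGamma1 f := by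
  refine le_antisymm ?_ (periodLatticeGamma1_le_periodLattice f)
  unfold periodLattice
  rw [AddSubgroup.closure_le]
  rintro _ ⟨γ, rfl⟩
  exact cuspSymbol_mem_periodLatticeGamma1_thirtySix f γ

/-- **`ShimuraIndexPrimeTo p f` for every `p` and every `f ∈ S₂(Γ₀(36))`** (the route predicate holds for free at `N = 36`).
[cite: LingOesterle1991, Thm. 1] -/
theorem shimuraIndexPrimeTo_thirtySix (p : ℕ) (f : CuspForm (Gamma0 36) 2) : ShimuraIndexPrimeTo p f :=
  fun x hx _ ↦ by rw [← periodLattice_eq_periodLatticeGamma1_thirtySix f]; exact hx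

/-- **C2 ∩ C3 datum at `N = 36`**: for every modular parametrisation datum of level `36` and every `p`, `ShimuraIndexPrimeTo p D.f`.
[cite: LingOesterle1991, Thm. 1] -/
theorem shimuraIndexPrimeTo_of_data_thirtySix (W : WeierstrassCurve ℚ) [W.IsElliptic]
    (D : ModularParametrizationData W 36) (p : ℕ) : ShimuraIndexPrimeTo p D.f :=
  shimuraIndexPrimeTo_thirtySix p D.f

/-! ## §3. Dimension-free descent: a covering class killing the period kernel of `f` is seen by `f` -/

/-- **DESCENT BY THE PERIOD KERNEL (dimension-free).** Let `φ : H₁(X₀(N), ℤ) → R` take the value `v k` on `{∞, k∞}` with `v = 0`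
on `Γ₁(N)`, and suppose `φ` KILLS THE PERIOD KERNEL of `f` (`x(f) = 0 ⇒ φ x = 0`). Then `n·v(γ) ≠ 0 ⇒ n·{∞, γ∞}_f ∉ Λ₁(f)`.
(On a line `S₂(Γ₀(N)) = ℂ·f` the kernel is `0` and this is the landed `ShimuraClass.zsmul_cuspSymbol_not_mem_of_hom`.)
[cite: Mazur1977, §II.11] -/
theorem zsmul_cuspSymbol_not_mem_of_hom_of_ker {N : ℕ} [NeZero N] {R : Type} [AddCommGroup R]
    (φ : periodHomology N →+ R) (v : Gamma0 N → R)
    (hφ : ∀ k : Gamma0 N, φ ⟨periodFunctional N k, periodFunctional_mem_periodHomology N k⟩ = v k)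
    (hv : ∀ γ₁ : Gamma1 N, v ⟨(γ₁ : SL(2, ℤ)), Gamma1_in_Gamma0 N γ₁.2⟩ = 0) (f : CuspForm (Gamma0 N) 2)
    (hker : ∀ x : periodHomology N, (x : Module.Dual ℂ (CuspForm (Gamma0 N) 2)) f = 0 → φ x = 0)
    (γ : Gamma0 N) (n : ℤ) (hγ : n • v γ ≠ 0) : (n : ℂ) * cuspSymbol f γ ∉ periodLatticeGamma1 f := by
  intro hmem
  have key : ∀ z ∈ periodLatticeGamma1 f, ∃ x : periodHomology N,
      (x : Module.Dual ℂ (CuspForm (Gamma0 N) 2)) f = z ∧ φ x = 0 := by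
    intro z hz
    refine AddSubgroup.closure_induction (fun z hz ↦ ?_) ?_ (fun x y _ _ hx hy ↦ ?_) (fun x _ hx ↦ ?_) hz
    · obtain ⟨γ₁, rfl⟩ := hz
      exact ⟨⟨periodFunctional N ⟨(γ₁ : SL(2, ℤ)), Gamma1_in_Gamma0 N γ₁.2⟩,
        periodFunctional_mem_periodHomology N _⟩, rfl, by rw [hφ, hv]⟩
    · exact ⟨0, by simp, map_zero φ⟩
    · obtain ⟨a, ha, ha0⟩ := hx
      obtain ⟨b, hb, hb0⟩ := hy
      exact ⟨a + b, by simp [ha, hb], by rw [map_add, ha0, hb0, add_zero]⟩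
    · obtain ⟨a, ha, ha0⟩ := hx
      exact ⟨-a, by simp [ha], by rw [map_neg, ha0, neg_zero]⟩
  obtain ⟨x, hx, hx0⟩ := key _ hmem
  have hmem' : n • periodFunctional N γ ∈ periodHomology N :=
    AddSubgroup.zsmul_mem _ (periodFunctional_mem_periodHomology N γ) n
  have hyf : ((⟨n • periodFunctional N γ, hmem'⟩ : periodHomology N) : Module.Dual ℂ (CuspForm (Gamma0 N) 2)) f =
      (n : ℂ) * cuspSymbol f γ := by
    show (n • periodFunctional N γ) f = _
    rw [LinearMap.smul_apply, periodFunctional_apply, zsmul_eq_mul]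
  have hdiff : ((x - ⟨n • periodFunctional N γ, hmem'⟩ : periodHomology N) : Module.Dual ℂ (CuspForm (Gamma0 N) 2)) f = 0 := by
    rw [AddSubgroupClass.coe_sub, LinearMap.sub_apply, hx, hyf, sub_self]
  have h0 := hker _ hdiff
  rw [map_sub, hx0, zero_sub, neg_eq_zero] at h0
  have hsm : (⟨n • periodFunctional N γ, hmem'⟩ : periodHomology N) =
      n • ⟨periodFunctional N γ, periodFunctional_mem_periodHomology N γ⟩ := rfl
  rw [hsm, map_zsmul, hφ] at h0
  exact hγ h0

/-- The line case recovers the kernel condition: if `S₂(Γ₀(N)) = ℂ·f` then `x(f) = 0 ⇒ x = 0` on `H₁(X₀(N), ℤ)`. [folklore] -/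
theorem periodHomology_eq_zero_of_apply_eq_zero_of_span {N : ℕ} [NeZero N] (f : CuspForm (Gamma0 N) 2)
    (hspan : ∀ w : CuspForm (Gamma0 N) 2, ∃ c : ℂ, c • f = w) (x : periodHomology N)
    (hx : (x : Module.Dual ℂ (CuspForm (Gamma0 N) 2)) f = 0) : x = 0 := by
  refine Subtype.ext (LinearMap.ext fun w ↦ ?_)
  obtain ⟨c, rfl⟩ := hspan w
  rw [map_smul, hx, smul_zero]
  rfl

end Summit.BirchSwinnertonDyer.BirchSwinnertonDyer.Theorems.ManinLocalTwoThree.ShimuraThirtySix
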